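import Summits.Ventures.CertifiedManyBodySolver.Rows.CorrWindowCertKernelChain
import HarnessLib

/-!
# EOM LOCALITY for kernel replays: `[H_{Λ'}, Γ B] = [H_near(B), Γ B]` — Hamiltonian terms with support disjoint from the generator
# (and even length) commute with it, so an eom slice only multiplies the FEW near terms; the far terms are discharged by a
# syntactic disjointness check

HONEST FRAMING: Lean plumbing towards «tier P» (HOME/STATUS «ANSWER (R0)–(R4)» 23:11:25Z, item (R3)(iii)): at the Rm2 geometry the
window Hamiltonian list `TH` has ≈ 10⁴ terms, so the eom slice `commT TH (Γ B)` of `Rows/CorrWindowCertKernelChain.lean` (2·|TH|·|B| raw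
products) exceeds the per-declaration envelope although its normal form is tiny. Here: (§1) graded commutation of Jordan–Wigner words
from the tree's CAR (`creation_mul_creation_eq_neg`, `annihilation_mul_creation`, `annihilation_anticommute_holds`): letters on distinct
orbitals anticommute, hence an EVEN word commutes with any word on disjoint orbitals; (§2) the Boolean check `farOK T B` (every term of `T`
even and letter-disjoint from every word of `B`; letters compared in the index alphabet, sound for an injective letter map) and
`termOp_commT_eq_zero_of_farOK`; (§3) the exporter's per-generator MASK splits `TH` into near/far (`splitMask`, any mask is sound), the
NEAR eom slices `eomNearSlices TH f EB masks`, the check `eomFarOK`, and `termOp_flatten_eomNearSlices` (= the full eom family); (§4) the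
residual sliced with near eom slices, `residTGslicesNear`, and `termOp_flatten_residTGslicesNear` (denotes `residTG`, given the check).
The closer consuming it is `Rows/CorrWindowCertKernelChainQuotAdjNearCloser.lean`. No certificate, no number of record;
CONTROL/CALIBRATION context (wording (xx1)); no summit statement is proved by this file. Seat hubbard-obs-p2 (STIFFNESS),
`prover-hubbard-obs-p2-g23-0`, zero compute.

References: O. Bratteli, D. W. Robinson, *Operator Algebras and Quantum Statistical Mechanics 2* §5.2.2 (CAR; graded commutation of
even elements with disjointly supported ones) [BratteliRobinsonII1997]; X. Han, arXiv:2006.06002 §3 (the eom family `ω([H, O]) = 0` with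
local `H`) [Han2020Bootstrap].
-/

namespace Summit.Ventures.CertifiedManyBodySolver

namespace CARPolyWindow

open Summit.Ventures.CertifiedQuantumChemistry Summit.Ventures.CertifiedQuantumChemistry.CARPoly
open Literature.MathematicalPhysics.QuantumLattice Literature.MathematicalPhysics.QuantumLattice.HubbardWave0
open Literature.MathematicalPhysics.QuantumManyBody.StateRelaxation
open Matrix
open scoped ComplexOrder BigOperators

/-! ## §1 Graded commutation of Jordan–Wigner words -/

section Graded

variable {ι : Type*} [LinearOrder ι] [Fintype ι]

/-- **Letters on distinct orbitals anticommute** (all four CAR cases). [cite: BratteliRobinsonII1997, §5.2.2] -/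
theorem ladderLetter_mul_of_ne {i j : ι} (hij : i ≠ j) (b c : Bool) :
    ladderLetter (i, b) * ladderLetter (j, c) = -(ladderLetter (j, c) * ladderLetter (i, b)) := by
  cases b <;> cases c <;> simp only [ladderLetter, Bool.false_eq_true, if_false, if_true]
  · exact eq_neg_of_add_eq_zero_left (annihilation_anticommute_holds i j)
  · rw [annihilation_mul_creation, if_neg hij, zero_sub]
  · have h := annihilation_mul_creation j i
    rw [if_neg (Ne.symm hij), zero_sub] at h
    rw [h, neg_neg]
  · exact creation_mul_creation_eq_neg i j

/-- A letter passes a word on other orbitals with the sign `(−1)^{|w|}`. [cite: BratteliRobinsonII1997, §5.2.2] -/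
theorem ladderLetter_mul_ladderWord_of_disjoint (p : ι × Bool) :
    ∀ w : List (ι × Bool), (∀ q ∈ w, q.1 ≠ p.1) →
      ladderLetter p * ladderWord w = ((-1 : ℂ) ^ w.length) • (ladderWord w * ladderLetter p)
  | [], _ => by simp
  | q :: w, h => by
    have hq : q.1 ≠ p.1 := h q (List.mem_cons_self)
    have ih := ladderLetter_mul_ladderWord_of_disjoint p w fun r hr => h r (List.mem_cons_of_mem _ hr)
    obtain ⟨i, b⟩ := p
    obtain ⟨j, c⟩ := q
    rw [ladderWord_cons, ← mul_assoc, ladderLetter_mul_of_ne (Ne.symm hq) b c, neg_mul, mul_assoc, ih, mul_smul_comm, ← mul_assoc,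
      List.length_cons, pow_succ, mul_comm ((-1 : ℂ) ^ w.length) (-1), mul_smul, neg_one_smul]

/-- **Words on disjoint orbitals commute up to `(−1)^{|w₁||w₂|}`.** [cite: BratteliRobinsonII1997, §5.2.2] -/
theorem ladderWord_mul_ladderWord_of_disjoint :
    ∀ (w₁ w₂ : List (ι × Bool)), (∀ p ∈ w₁, ∀ q ∈ w₂, p.1 ≠ q.1) →
      ladderWord w₁ * ladderWord w₂ = ((-1 : ℂ) ^ (w₁.length * w₂.length)) • (ladderWord w₂ * ladderWord w₁)
  | [], w₂, _ => by simp
  | p :: w₁, w₂, h => by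
    have hp : ∀ q ∈ w₂, q.1 ≠ p.1 := fun q hq => Ne.symm (h p (List.mem_cons_self) q hq)
    have ih := ladderWord_mul_ladderWord_of_disjoint w₁ w₂ fun r hr q hq => h r (List.mem_cons_of_mem _ hr) q hq
    rw [ladderWord_cons, mul_assoc, ih, mul_smul_comm, ← mul_assoc, ladderLetter_mul_ladderWord_of_disjoint p w₂ hp, smul_mul_assoc,
      mul_assoc, smul_smul, List.length_cons, Nat.succ_mul, pow_add]

/-- **An EVEN word commutes with any word on disjoint orbitals.** [cite: BratteliRobinsonII1997, §5.2.2] -/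
theorem ladderWord_comm_of_disjoint_even (w₁ w₂ : List (ι × Bool)) (h : ∀ p ∈ w₁, ∀ q ∈ w₂, p.1 ≠ q.1) (he : w₁.length % 2 = 0) :
    ladderWord w₁ * ladderWord w₂ = ladderWord w₂ * ladderWord w₁ := by
  rw [ladderWord_mul_ladderWord_of_disjoint w₁ w₂ h]
  obtain ⟨k, hk⟩ : ∃ k, w₁.length = 2 * k := ⟨w₁.length / 2, by omega⟩
  rw [hk, mul_assoc, pow_mul, neg_one_sq, one_pow, one_smul]

end Graded

/-! ## §2 The syntactic far-check and the vanishing commutator -/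

section FarCheck

variable {α : Type*} [DecidableEq α] {ι : Type*} [LinearOrder ι] [Fintype ι]

/-- Two syntactic words share no letter index. [folklore] -/
def disjW (w₁ w₂ : List (α × Bool)) : Bool := w₁.all fun p => w₂.all fun q => !decide (p.1 = q.1)

/-- **The far check**: every term of `T` has even length and is index-disjoint from every word of `B`. [folklore] -/
def farOK (T B : Terms α) : Bool := T.all fun t => decide (t.1.length % 2 = 0) && B.all fun b => disjW t.1 b.1

omit [LinearOrder ι] [Fintype ι] in
/-- Index-disjoint words are orbital-disjoint under an injective letter map. [folklore] -/
theorem disjoint_wmap_of_disjW {d : α → ι} (hd : Function.Injective d) {w₁ w₂ : List (α × Bool)} (h : disjW w₁ w₂ = true) :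
    ∀ p ∈ wmap d w₁, ∀ q ∈ wmap d w₂, p.1 ≠ q.1 := by
  intro p hp q hq
  simp only [wmap, List.mem_map] at hp hq
  obtain ⟨a, ha, rfl⟩ := hp
  obtain ⟨b, hb, rfl⟩ := hq
  simp only [disjW, List.all_eq_true, Bool.not_eq_true', decide_eq_false_iff_not] at h
  exact fun hab => h a ha b hb (hd hab)

omit [LinearOrder ι] [Fintype ι] in
omit [DecidableEq α] in
/-- `wmap` preserves length. [folklore] -/
theorem length_wmap (d : α → ι) (w : List (α × Bool)) : (wmap d w).length = w.length := List.length_map _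

/-- One even far word commutes with a whole term list. [cite: BratteliRobinsonII1997, §5.2.2] -/
theorem ladderWord_mul_termOp_comm {d : α → ι} (hd : Function.Injective d) (w : List (α × Bool)) (he : w.length % 2 = 0) :
    ∀ B : Terms α, (∀ b ∈ B, disjW w b.1 = true) →
      ladderWord (wmap d w) * termOp d B = termOp d B * ladderWord (wmap d w)
  | [], _ => by simp
  | b :: B, h => by
    have ih := ladderWord_mul_termOp_comm hd w he B fun b' hb' => h b' (List.mem_cons_of_mem _ hb')
    have hb := h b (List.mem_cons_self)
    rw [termOp_cons, mul_add, add_mul, ih, mul_smul_comm, smul_mul_assoc,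
      ladderWord_comm_of_disjoint_even _ _ (disjoint_wmap_of_disjW hd hb) (by rw [length_wmap]; exact he)]

/-- **A far Hamiltonian part commutes with the generator: `termOp (commT T B) = 0` when `farOK T B`.**
[cite: BratteliRobinsonII1997, §5.2.2] [cite: Han2020Bootstrap, §3] -/
theorem termOp_commT_eq_zero_of_farOK {d : α → ι} (hd : Function.Injective d) :
    ∀ (T B : Terms α), farOK T B = true → termOp d (commT T B) = 0
  | [], B, _ => by rw [termOp_commT, termOp_nil, zero_mul, mul_zero, sub_self]
  | t :: T, B, h => by
    have h' : (decide (t.1.length % 2 = 0) && B.all fun b => disjW t.1 b.1) = true ∧ farOK T B = true := by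
      simpa [farOK, List.all_cons] using h
    have ih := termOp_commT_eq_zero_of_farOK hd T B h'.2
    rw [termOp_commT] at ih ⊢
    rw [termOp_cons, add_mul, mul_add]
    have ht : (decide (t.1.length % 2 = 0) = true) ∧ (B.all fun b => disjW t.1 b.1) = true := by
      simpa [Bool.and_eq_true] using h'.1
    have he : t.1.length % 2 = 0 := of_decide_eq_true ht.1
    have hB : ∀ b ∈ B, disjW t.1 b.1 = true := by simpa [List.all_eq_true] using ht.2
    rw [smul_mul_assoc, mul_smul_comm, ladderWord_mul_termOp_comm hd t.1 he B hB]
    rw [sub_eq_zero] at ih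
    rw [ih, sub_self]

end FarCheck

/-! ## §3 Near eom slices from a mask -/

section NearEom

variable {α β : Type*} [DecidableEq α] {ι : Type*} [LinearOrder ι] [Fintype ι]

/-- Split a term list by a Boolean mask (`true` = near, `false` or missing = far); any mask is sound. [folklore] -/
def splitMask : Terms α → List Bool → Terms α × Terms α
  | [], _ => ([], [])
  | t :: T, [] => ((splitMask T []).1, t :: (splitMask T []).2)
  | t :: T, true :: M => (t :: (splitMask T M).1, (splitMask T M).2)
  | t :: T, false :: M => ((splitMask T M).1, t :: (splitMask T M).2)

omit [DecidableEq α] in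
/-- A split term list denotes the sum of its parts. [folklore] -/
theorem termOp_splitMask (d : α → ι) : ∀ (T : Terms α) (M : List Bool),
    termOp d T = termOp d (splitMask T M).1 + termOp d (splitMask T M).2
  | [], _ => by simp [splitMask]
  | t :: T, [] => by rw [splitMask, termOp_cons, termOp_cons, termOp_splitMask d T []]; abel
  | t :: T, true :: M => by rw [splitMask, termOp_cons, termOp_cons, termOp_splitMask d T M]; abel
  | t :: T, false :: M => by rw [splitMask, termOp_cons, termOp_cons, termOp_splitMask d T M]; abel

/-- **The NEAR eom slices**: one slice `−[TH_near(k), Γ B_k]` per generator, `TH_near(k)` selected by the k-th mask.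
[cite: Han2020Bootstrap, §3] -/
def eomNearSlices (TH : Terms α) (f : β → α) (EB : List (Terms β)) (masks : List (List Bool)) : List (Terms α) :=
  (finL EB.length).map fun k => negT (commT (splitMask TH (masks.getD k.val [])).1 (wmapT f (EB.get k)))

/-- **The far check of all generators.** [folklore] -/
def eomFarOK (TH : Terms α) (f : β → α) (EB : List (Terms β)) (masks : List (List Bool)) : Bool :=
  (finL EB.length).all fun k => farOK (splitMask TH (masks.getD k.val [])).2 (wmapT f (EB.get k))

/-- `List.all` over `finL n` is a universal statement over `Fin n`. [folklore] -/
theorem all_finL {n : ℕ} {P : Fin n → Bool} (h : (finL n).all P = true) : ∀ k : Fin n, P k = true := by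
  have hmem : ∀ (n : ℕ) (k : Fin n), k ∈ finL n := by
    intro n
    induction n with
    | zero => intro k; exact k.elim0
    | succ n ih =>
      intro k
      rw [finL]
      refine Fin.cases (List.mem_cons_self) (fun j => ?_) k
      exact List.mem_cons_of_mem _ (List.mem_map.2 ⟨j, ih j, rfl⟩)
  intro k
  exact List.all_eq_true.1 h k (hmem n k)

/-- **The near eom slices denote the FULL eom family** when the far check passes. [cite: Han2020Bootstrap, §3]
[cite: BratteliRobinsonII1997, §5.2.2] -/
theorem termOp_flatten_eomNearSlices {d : α → ι} (hd : Function.Injective d) (TH : Terms α) (f : β → α) (EB : List (Terms β))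
    (masks : List (List Bool)) (hfar : eomFarOK TH f EB masks = true) :
    termOp d (eomNearSlices TH f EB masks).flatten = termOp d (negT (eomTβ TH f EB)) := by
  rw [eomNearSlices, flatten_map_eq_flatMap, termOp_flatMap_finL, termOp_negT, eomTβ, termOp_flatMap_get, ← Finset.sum_neg_distrib]
  refine Finset.sum_congr rfl fun k _ => ?_
  have hk := all_finL (P := fun k => farOK (splitMask TH (masks.getD k.val [])).2 (wmapT f (EB.get k))) hfar k
  have hz := termOp_commT_eq_zero_of_farOK hd _ _ hk
  rw [termOp_commT] at hz
  rw [termOp_negT, termOp_commT, termOp_commT, termOp_splitMask d TH (masks.getD k.val []), add_mul, mul_add]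
  rw [sub_eq_zero] at hz
  rw [hz]
  abel

end NearEom

/-! ## §4 The residual with near eom slices -/

section ResidualNear

variable {α β : Type*} [DecidableEq α] {ι : Type*} [LinearOrder ι] [Fintype ι]

/-- **The SLICED residual, eom-near edition**: as `residTGslices` but with the near eom slices selected by the masks.
[cite: WangEtAl2024, §III] [cite: Han2020Bootstrap, §3] -/
def residTGslicesNear (TX : Terms α) (μ : Fin 2 → ℚ) (ν : ℚ) (o : Fin 2 → α) (κhi hi κlo lo : ℚ) (TE : Terms α)
    (TGs : List (Terms α)) (TH : Terms α) (f : β → α) (EB : List (Terms β)) (masks : List (List Bool))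
    {nS : ℕ} (g : Fin nS → β → α) (SY : Fin nS → Terms β) (CW : Terms α) (AV : List (Terms α)) : List (Terms α) :=
  [headSliceT TX μ ν o κhi hi κlo lo TE] ++ TGs.map negT ++ eomNearSlices TH f EB masks
    ++ (finL nS).map (fun l => negT (wmapT (g l) (SY l) ++ negT (wmapT f (SY l)))) ++ [negT CW, negT (ahT AV)]

/-- **The eom-near slices denote the residual** (given the far check). [cite: WangEtAl2024, §III] [cite: Han2020Bootstrap, §3] -/
theorem termOp_flatten_residTGslicesNear {d : α → ι} (hd : Function.Injective d)
    (TX : Terms α) (μ : Fin 2 → ℚ) (ν : ℚ) (o : Fin 2 → α) (κhi hi κlo lo : ℚ) (TE : Terms α)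
    (TGs : List (Terms α)) (TH : Terms α) (f : β → α) (EB : List (Terms β)) (masks : List (List Bool))
    {nS : ℕ} (g : Fin nS → β → α) (SY : Fin nS → Terms β) (CW : Terms α) (AV : List (Terms α))
    (hfar : eomFarOK TH f EB masks = true) :
    termOp d (residTGslicesNear TX μ ν o κhi hi κlo lo TE TGs TH f EB masks g SY CW AV).flatten =
      termOp d (residTG TX μ ν o κhi hi κlo lo TE TGs.flatten TH f EB g SY CW AV) := by
  have hE : termOp d (eomNearSlices TH f EB masks).flatten =
      termOp d (EB.map fun B => negT (commT TH (wmapT f B))).flatten := by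
    rw [termOp_flatten_eomNearSlices hd TH f EB masks hfar, eomTβ, ← negT_flatMap]
  rw [← flatten_residTGslices, residTGslicesNear, residTGslices]
  simp only [List.flatten_append, termOp_append, hE]

end ResidualNear

end CARPolyWindow

end Summit.Ventures.CertifiedManyBodySolver
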